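import Summits.HodgeConjecture.HodgeConjecture.Theorems.PadicSemiregularLiftHodgeLocusPropagationProof

/-!
# Route PadicSemiregularLift — the algebraicity locus of a global class is a countable union of
# `ℚ̄`-closed strata: the vendored fact `voisin2007_algebraicityLocus_iUnion_qbarClosed` PROVED

HONEST FRAMING: research route conditional on HC_CM; not a corollary; Q11.4-sentence-2 already refuted in dim ≥ 3.
Helper file (no definition, no named fact, no `sorry`; `HC_CM` does not occur). Cell `pub-hodge-ring2`,
binder seat `ring2-b03` (gen 42). Sequel of `PadicSemiregularLiftHodgeLocusPropagationProof.lean`.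

* `familyPullback_baseChangeHom` — bookkeeping used twice: for `ι : S₁ ⟶ S₀` over `k`, the
  complexification of the pulled-back family `𝒳₀ ×_{S₀} S₁ → S₁` is again a smooth projective
  family, and `q^* A` is algebraic on its fibre over `w` iff `A` is algebraic on the fibre of the
  original family over the image of `w` (`exists_fiberOver_iso_of_isPullback`).
* `mem_algebraicClasses_of_base_pt_eq_genericPoint` — **propagation over ANY irreducible base
  locally of finite type** (no quasi-projectivity of base or total space, `k` countable
  algebraically closed): algebraic at one complex point over the generic point of `S₀` ⟹ algebraic
  at every complex point. This is the body of `hodgeLocusPropagation_proof` with the two uses of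
  quasi-projectivity of `S₀` (finite type; `ℚ̄`-generic ⟺ over the generic point) removed.
* `voisin2007_algebraicityLocus_iUnion_qbarClosed_holds` — **the Literature named fact
  `HodgeTheory.voisin2007_algebraicityLocus_iUnion_qbarClosed` (Voisin 2007 §0 / Charles–Schnell
  Prop. 11.3.11: for a smooth projective family over a quasi-projective `ℚ̄`-base the set of complex
  points with algebraic fibre class is `⋃_j W_j(ℂ)` for countably many closed `W_j ⊆ S₀`) is a
  THEOREM** — and its hypothesis `IsQuasiProjectiveOver 𝒳₀` is not used: take for the `W_j` the
  closures `\overline{x}` of the (countably many, `countable_of_locallyOfFiniteType`) points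
  `x ∈ S₀` under which some complex point has algebraic fibre class; if `w` over `x` is such a
  point and `t` lies over `\overline{x}`, pull the family back to the closed subscheme
  `V(\overline{x})` (Mathlib `IdealSheafData.vanishingIdeal … |>.subscheme`, irreducible with
  generic point over `x`), lift `w` and `t` to it (`exists_map_eq_of_base_pt_eq`) and apply
  `mem_algebraicClasses_of_base_pt_eq_genericPoint`. The printed proof (relative Hilbert schemes of
  the projective morphism `f₀`) is replaced by the support-and-curve argument of this seat's files;
  the consumers `voisin2007_algebraicityLocus_iUnion_qbarClosed.mem_of_qbarGeneric`,
  `HodgeLocusPropagation_of_isQuasiProjective` and `Ring2DeformQbarSpreading` become unconditional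
  by feeding this theorem.

References: [Voisin2007HodgeLoci] §0, Lemma 1.4, §3; [CharlesSchnell2014Notes] Prop. 11.3.11
(proof), Lemma 11.3.14; [VoisinHodgeII2003] §3.3.1; [Lang1958IAG] II §3, III §4–5.
-/

noncomputable section

-- every declaration of this problem lives in `Summit.HodgeConjecture.HodgeConjecture.…` (summit = sub-problem)
set_option linter.dupNamespace false

open CategoryTheory CategoryTheory.Limits AlgebraicGeometry TopologicalSpace Order Cardinal
open Literature.AlgebraicGeometry.Motives Literature.AlgebraicGeometry.HodgeTheory

namespace Summit.HodgeConjecture.HodgeConjecture.Theorems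

/-! ### Pulling the family back along a morphism of bases -/

section Pullback

variable {k : Type} [Field k] (σ : k →+* ℂ) {𝒳₀ S₀ S₁ : SchemeOver k} (f₀ : 𝒳₀ ⟶ S₀)
  (ι : S₁ ⟶ S₀)

/-- **The complexified pull-back of the family along `ι : S₁ ⟶ S₀`** is a smooth projective family
of the same relative dimension, and `q^* A` is algebraic on its fibre over a complex point `w` iff
`A` is algebraic on the fibre of the original family over `ι(w)` (both fibres are
`𝒳₀ ×_{S₀} Spec ℂ`; base change preserves cartesian squares, `isPullback_baseChangeHom_map_of_isPullback`;
`Nᵖ` is invariant under isomorphisms). [cite: GortzWedhorn2020, Prop. 4.16 and §(4.7)] -/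
theorem familyPullback_baseChangeHom {n : ℕ}
    (hf : IsSmoothProjectiveFamily ((baseChangeHom σ).map f₀) n) (p : ℕ)
    (A : complexBetti ((baseChangeHom σ).obj 𝒳₀) (2 * p)) :
    IsSmoothProjectiveFamily ((baseChangeHom σ).map (familyPullback.snd f₀ ι)) n ∧
      ∀ w : ComplexPoints ((baseChangeHom σ).obj S₁),
        complexBetti.map (fiberι ((baseChangeHom σ).map (familyPullback.snd f₀ ι)) w) (2 * p)
            (complexBetti.map ((baseChangeHom σ).map (familyPullback.fst f₀ ι)) (2 * p) A) ∈
          algebraicClasses (fiberOver ((baseChangeHom σ).map (familyPullback.snd f₀ ι)) w) p ↔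
        complexBetti.map (fiberι ((baseChangeHom σ).map f₀)
            (AlgPoints.map ((baseChangeHom σ).map ι) w)) (2 * p) A ∈
          algebraicClasses (fiberOver ((baseChangeHom σ).map f₀)
            (AlgPoints.map ((baseChangeHom σ).map ι) w)) p := by
  let f : (baseChangeHom σ).obj 𝒳₀ ⟶ (baseChangeHom σ).obj S₀ := (baseChangeHom σ).map f₀
  let f' : (baseChangeHom σ).obj (familyPullback f₀ ι) ⟶ (baseChangeHom σ).obj S₁ :=
    (baseChangeHom σ).map (familyPullback.snd f₀ ι)
  let q' : (baseChangeHom σ).obj (familyPullback f₀ ι) ⟶ (baseChangeHom σ).obj 𝒳₀ :=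
    (baseChangeHom σ).map (familyPullback.fst f₀ ι)
  let h' : (baseChangeHom σ).obj S₁ ⟶ (baseChangeHom σ).obj S₀ := (baseChangeHom σ).map ι
  have Hsq : IsPullback (familyPullback.fst f₀ ι).left (familyPullback.snd f₀ ι).left f₀.left ι.left :=
    IsPullback.of_hasPullback f₀.left ι.left
  have HsqC : IsPullback q' f' f h' := isPullback_baseChangeHom_map_of_isPullback' σ Hsq
  have Hl : IsPullback q'.left f'.left f.left h'.left := isPullback_baseChangeHom_map_of_isPullback σ Hsq
  refine ⟨⟨?_, ?_, fun w => ?_⟩, fun w => ?_⟩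
  · haveI := smoothOfRelativeDimension_isStableUnderBaseChange (n := n)
    exact MorphismProperty.of_isPullback (P := @SmoothOfRelativeDimension n) Hl
      hf.smoothOfRelativeDimension
  · exact MorphismProperty.of_isPullback (P := @IsProper) Hl hf.isProper
  · obtain ⟨φ, -⟩ := exists_fiberOver_iso_of_isPullback HsqC w
    exact (hf.isSmoothProjective _).of_iso φ.symm
  · obtain ⟨φ, hφ⟩ := exists_fiberOver_iso_of_isPullback HsqC w
    change complexBetti.map (fiberι f' w) (2 * p) (complexBetti.map q' (2 * p) A) ∈
        algebraicClasses (fiberOver f' w) p ↔ _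
    rw [map_fiberι_map_eq_map_of_fiberIso f q' f' φ hφ (2 * p) A]
    exact mem_algebraicClasses_map_iff_of_iso φ

end Pullback

/-! ### Propagation over any irreducible base locally of finite type -/

/-- **Propagation of algebraicity from a complex point over the generic point to every complex
point, over ANY irreducible base locally of finite type** (`k` countable algebraically closed; no
quasi-projectivity of base or total space; the base may be singular and non-reduced). Proof:
pull back to an integral affine `S₁ → S₀` through the point under `t`
(`exists_isIntegral_isAffine_isDominant`), lift `s` to a complex point over the generic point of
`S₁` and `t` to some complex point (`exists_map_eq_of_base_pt_eq`), then
`mem_algebraicClasses_of_base_pt_eq_genericPoint_of_base_pt_eq_genericPoint` and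
`mem_algebraicClasses_of_forall_base_pt_eq_genericPoint`. [cite: VoisinHodgeII2003, §3.3.1]
[cite: CharlesSchnell2014Notes, Prop. 11.3.11 (proof) and Lemma 11.3.14] -/
theorem mem_algebraicClasses_of_base_pt_eq_genericPoint (k : Type) [Field k] [Countable k]
    [IsAlgClosed k] (σ : k →+* ℂ) ⦃n : ℕ⦄ ⦃𝒳₀ S₀ : SchemeOver k⦄ (f₀ : 𝒳₀ ⟶ S₀)
    [IrreducibleSpace S₀.left] [LocallyOfFiniteType S₀.hom]
    (hf : IsSmoothProjectiveFamily ((baseChangeHom σ).map f₀) n)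
    (p : ℕ) (A : complexBetti ((baseChangeHom σ).obj 𝒳₀) (2 * p))
    (s : ComplexPoints ((baseChangeHom σ).obj S₀))
    (hs : (baseChangeHomFst σ S₀).base s.pt = genericPoint S₀.left)
    (hA : complexBetti.map (fiberι ((baseChangeHom σ).map f₀) s) (2 * p) A ∈
      algebraicClasses (fiberOver ((baseChangeHom σ).map f₀) s) p)
    (t : ComplexPoints ((baseChangeHom σ).obj S₀)) :
    complexBetti.map (fiberι ((baseChangeHom σ).map f₀) t) (2 * p) A ∈
      algebraicClasses (fiberOver ((baseChangeHom σ).map f₀) t) p := by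
  classical
  letI := σ.toAlgebra
  have hK : #k ≤ ℵ₀ := Cardinal.mk_le_aleph0
  let prS : ((baseChangeHom σ).obj S₀).left ⟶ S₀.left := baseChangeHomFst σ S₀
  -- an integral affine `S₁ → S₀`, dominant, through the point under `t`
  obtain ⟨S₁, ι, hS₁int, hS₁aff, hιlft, hιdom, y, hy⟩ :=
    exists_isIntegral_isAffine_isDominant S₀ (prS.base t.pt)
  haveI := hS₁int
  haveI := hS₁aff
  haveI := hιlft
  haveI := hιdom
  haveI : LocallyOfFiniteType S₁.hom := by rw [← Over.w ι]; infer_instance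
  haveI : IsAffineHom S₁.hom := isAffineHom_of_isAffine S₁.hom
  haveI : CompactSpace S₁.left := QuasiCompact.compactSpace_of_compactSpace S₁.hom
  obtain ⟨hf', hfib⟩ := familyPullback_baseChangeHom σ f₀ ι hf p A
  -- lift `s` over the generic point of `S₁`, and `t`
  have hη : ι.left.base (genericPoint S₁.left) = prS.base s.pt := by
    rw [hs]; exact genericPoint_eq_of_isDominant' ι.left
  obtain ⟨s', hs'η, hs's⟩ := exists_map_eq_of_base_pt_eq (σ := σ) ι hK hη
  obtain ⟨t', -, ht't⟩ := exists_map_eq_of_base_pt_eq (σ := σ) ι hK (y := y) (t := t) hy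
  have hA' := (hfib s').mpr (by rw [hs's]; exact hA)
  have hgen := fun v hv =>
    mem_algebraicClasses_of_base_pt_eq_genericPoint_of_base_pt_eq_genericPoint k σ
      (familyPullback.snd f₀ ι) hf' p _ s' hs'η hA' v hv
  have ht' := mem_algebraicClasses_of_forall_base_pt_eq_genericPoint k σ (familyPullback.snd f₀ ι)
    hf' p _ hgen t'
  have ht := (hfib t').mp ht'
  rwa [ht't] at ht

/-! ### The vendored structure fact on algebraicity loci -/

/-- **`voisin2007_algebraicityLocus_iUnion_qbarClosed` is a theorem**: for `σ : ℚ̄ →+* ℂ`, a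
family `f₀ : 𝒳₀ ⟶ S₀` over `ℚ̄` with `S₀` quasi-projective whose complexification is a smooth
projective family, and a global class `A`, the complex points `t` with `A|_{𝒳_t}` algebraic are
exactly those over countably many closed `W_j ⊆ S₀` — namely the closures of the points of `S₀`
under which some complex point has algebraic fibre class (propagation along each such closed
irreducible stratum, `mem_algebraicClasses_of_base_pt_eq_genericPoint` on the closed subscheme
`V(\overline{x})`). The printed hypothesis "`𝒳₀` quasi-projective" is not used.
[cite: Voisin2007HodgeLoci, §0 (Introduction), first paragraph] [cite: CharlesSchnell2014Notes, Prop. 11.3.11 (proof)]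
[cite: VoisinHodgeII2003, §3.3.1] -/
theorem voisin2007_algebraicityLocus_iUnion_qbarClosed_holds :
    voisin2007_algebraicityLocus_iUnion_qbarClosed := by
  intro σ 𝒳₀ S₀ f₀ n p _h𝒳₀ hS₀ hf A
  classical
  letI := σ.toAlgebra
  haveI : Countable (AlgebraicClosure ℚ) :=
    Cardinal.mk_le_aleph0_iff.mp cardinalMk_algebraicClosure_rat_le_aleph0
  have hK : #(AlgebraicClosure ℚ) ≤ ℵ₀ := cardinalMk_algebraicClosure_rat_le_aleph0
  haveI : LocallyOfFiniteType S₀.hom := locallyOfFiniteType_of_isQuasiProjectiveOver hS₀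
  haveI : QuasiCompact S₀.hom := hS₀.isVarietyPair_ofScheme.quasiCompact
  haveI : CompactSpace S₀.left := QuasiCompact.compactSpace_of_compactSpace S₀.hom
  haveI : Countable S₀.left := countable_of_locallyOfFiniteType S₀.hom
  -- notation
  let S : SchemeOver ℂ := (baseChangeHom σ).obj S₀
  let f : (baseChangeHom σ).obj 𝒳₀ ⟶ S := (baseChangeHom σ).map f₀
  let prS : S.left ⟶ S₀.left := baseChangeHomFst σ S₀
  let L : Set (ComplexPoints S) :=
    {t | complexBetti.map (fiberι f t) (2 * p) A ∈ algebraicClasses (fiberOver f t) p}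
  -- the points of `S₀` under the locus
  let G : Set S₀.left := {x | ∃ w : ComplexPoints S, prS.base w.pt = x ∧ w ∈ L}
  -- ### key step: the locus is saturated along the closure of each of its points of `S₀`
  have key : ∀ x ∈ G, ∀ t : ComplexPoints S, prS.base t.pt ∈ closure ({x} : Set S₀.left) → t ∈ L := by
    rintro x ⟨w, hwx, hwL⟩ t htx
    -- the closed subscheme `Y = V(closure {x})` of `S₀`
    let Z : Closeds S₀.left := ⟨closure {x}, isClosed_closure⟩
    let I : S₀.left.IdealSheafData := Scheme.IdealSheafData.vanishingIdeal Z
    let Y₀ : SchemeOver (AlgebraicClosure ℚ) := Over.mk (I.subschemeι ≫ S₀.hom)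
    let ι₀ : Y₀ ⟶ S₀ := Over.homMk I.subschemeι rfl
    have hrange : Set.range ι₀.left.base = closure {x} := by
      change Set.range I.subschemeι.base = closure {x}
      rw [Scheme.IdealSheafData.range_subschemeι, Scheme.IdealSheafData.coe_support_vanishingIdeal]
      rfl
    haveI : IsClosedImmersion ι₀.left := inferInstanceAs (IsClosedImmersion I.subschemeι)
    haveI : LocallyOfFiniteType ι₀.left := inferInstance
    haveI : LocallyOfFiniteType Y₀.hom := by rw [← Over.w ι₀]; infer_instance
    -- a point `y₀` of `Y₀` over `x`; it is a generic point, so `Y₀` is irreducible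
    obtain ⟨y₀, hy₀⟩ : x ∈ Set.range ι₀.left.base := by
      rw [hrange]; exact subset_closure (Set.mem_singleton x)
    have hcl : closure ({y₀} : Set Y₀.left) = Set.univ := by
      rw [ι₀.left.isClosedEmbedding.isInducing.closure_eq_preimage_closure_image,
        Set.image_singleton, hy₀, ← hrange, Set.preimage_range]
    haveI : IrreducibleSpace Y₀.left :=
      (irreducibleSpace_def _).2 (IsGenericPoint.isIrreducible (S := Set.univ) hcl)
    have hgen : genericPoint Y₀.left = y₀ := (genericPoint_spec Y₀.left).eq hcl
    -- pull the family back to `Y₀`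
    obtain ⟨hf', hfib⟩ := familyPullback_baseChangeHom σ f₀ ι₀ hf p A
    -- lift `w` over the generic point of `Y₀`, and `t`
    have hη : ι₀.left.base (genericPoint Y₀.left) = prS.base w.pt := by rw [hgen, hy₀, hwx]
    obtain ⟨w', hw'η, hw'w⟩ := exists_map_eq_of_base_pt_eq (σ := σ) ι₀ hK hη
    obtain ⟨yt, hyt⟩ : prS.base t.pt ∈ Set.range ι₀.left.base := by rw [hrange]; exact htx
    obtain ⟨t', -, ht't⟩ := exists_map_eq_of_base_pt_eq (σ := σ) ι₀ hK (y := yt) (t := t) hyt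
    have hA' := (hfib w').mpr (by rw [hw'w]; exact hwL)
    have ht' := mem_algebraicClasses_of_base_pt_eq_genericPoint (AlgebraicClosure ℚ) σ
      (familyPullback.snd f₀ ι₀) hf' p _ w' hw'η hA' t'
    have ht := (hfib t').mp ht'
    rw [ht't] at ht
    exact ht
  -- ### the countably many closed strata
  let 𝒲 : Set (Set S₀.left) := insert ∅ ((fun x => closure ({x} : Set S₀.left)) '' G)
  have h𝒲c : 𝒲.Countable := ((Set.to_countable G).image _).insert _
  have h𝒲ne : 𝒲.Nonempty := ⟨∅, Set.mem_insert _ _⟩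
  obtain ⟨W, hW⟩ := h𝒲c.exists_eq_range h𝒲ne
  have hWmem : ∀ j, W j ∈ 𝒲 := fun j => hW ▸ Set.mem_range_self j
  refine ⟨W, fun j => ?_, ?_⟩
  · rcases Set.mem_insert_iff.1 (hWmem j) with h | ⟨x, -, h⟩
    · rw [h]; exact isClosed_empty
    · rw [← h]; exact isClosed_closure
  · ext t
    simp only [Set.mem_iUnion, Set.mem_setOf_eq]
    constructor
    · intro ht
      have hxG : prS.base t.pt ∈ G := ⟨t, rfl, ht⟩
      have hmem : closure ({prS.base t.pt} : Set S₀.left) ∈ 𝒲 :=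
        Set.mem_insert_of_mem _ ⟨_, hxG, rfl⟩
      rw [hW] at hmem
      obtain ⟨j, hj⟩ := hmem
      exact ⟨j, by rw [hj]; exact subset_closure (Set.mem_singleton _)⟩
    · rintro ⟨j, hj⟩
      rcases Set.mem_insert_iff.1 (hWmem j) with h | ⟨x, hxG, h⟩
      · rw [h] at hj; exact absurd hj (Set.notMem_empty _)
      · rw [← h] at hj
        exact key x hxG t hj

end Summit.HodgeConjecture.HodgeConjecture.Theorems

end
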